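import Summits.BirchSwinnertonDyer.Uniform.U2.TwistTamagawaTwoAdicMult
import HarnessLib

/-!
# Track U2 (cell `bsd-uniform`, seat u2-p1): the `2`-adic Tamagawa balance `hc` for `d ≡ 5 (mod 8)`
# — the twist by a `2`-adically UNRAMIFIED non-square is harmless at a base with GOOD reduction at `2`

HONEST FRAMING (cell `bsd-uniform`, HOME run/shared/lean/pub/bsd-uniform/): local arithmetic of
Tamagawa numbers under quadratic twists; no claim about BSD beyond the displayed identity, nothing
booked, no census number moves, no per-curve certificate is counted as a uniform theorem. THIS FILE
removes the last use of `d ≡ 1 (mod 8)` from the Tamagawa balance of the U2 heads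
(`padicValNat_two_tamagawaProduct_twist_eq_of_mazurRubin`, p522556): there `d ≡ 1 (mod 8)` served ONE
purpose — at `ℓ = 2 ∣ N`, `d ∈ (ℚ₂^×)²` makes `E^{(d)} ≅ E` over `ℚ₂`. If instead `E` has GOOD
reduction at `2` (`2 ∤ N`), then for ANY `d ≡ 1 (mod 4)` (so `2 ∤ d`, the twist `ℚ(√d)/ℚ` is
unramified at `2`) the twist `E^{(d)}` has good reduction at `2` as well — `ℓ = 2` INCLUDED, by the
integral twist model «completing the square» (tree `Rank1Residual.X2.hasGoodReductionAt_twist_of_not_dvd`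
/ `localTamagawaNumber_twist_of_not_dvd`, Silverman *AEC* VII.1 Prop. 1.3, VII.5 Prop. 5.1(a)) — so
`c₂(E^{(d)}) = c₂(E) = 1`. Hence the balance holds on the a_q-odd class for `d ≡ 1 (mod 4)` under
«`d ≡ 1 (mod 8)` OR `E` good at `2`»: the `d ≡ 5 (mod 8)` half of the class (HOME/RESIDUE.md R-A3′,
«REMOVED for bases with GOOD reduction at 2») now has its Tamagawa balance too.

## Contents (theorems only; no `def`, no named fact)
* `padicValNat_two_localTamagawaNumber_twist_eq_of_unramified` — prime by prime.
* **`padicValNat_two_tamagawaProduct_twist_eq_of_unramified`** — `ord₂ ∏ c_ℓ(E^{(d)}) = ord₂ ∏ c_ℓ(E)`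
  under the Mazur–Rubin binders `hadd` / `hmev` of the U2 heads, `hS`, `d ≡ 1 (mod 4)` and
  «`d ≡ 1 (mod 8)` ∨ `E` good at `2`».

References: Silverman *ATAEC* (1994) Cor. IV.9.2(d), IV.9.4 Step 2 [SilvermanATAEC1994];
Silverman *AEC* 2nd ed. (2009) VII.1 Prop. 1.3, VII.5 Prop. 5.1, VII.6, X.5 Cor. 5.4 [SilvermanAEC2009];
Mazur–Rubin 2010 Prop. 3.3, Lemma 2.10 [MazurRubin2010]; HOME/RESIDUE.md R-A3′ / R-A7.
-/

set_option autoImplicit false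

noncomputable section

open scoped Classical

open IsDedekindDomain NumberField Rat.HeightOneSpectrum WeierstrassCurve
  Literature.NumberTheory.EllipticCurves

namespace Summit.BirchSwinnertonDyer.Uniform.U2

/-! ## §1 Prime by prime, `d ≡ 1 (mod 4)`, «`d ≡ 1 (mod 8)` or good at `2`» -/

/-- **`ord₂ c_ℓ(E^{(d)}) = ord₂ c_ℓ(E)` at every prime `ℓ`**, for `W / ℚ` globally minimal, `d ≡ 1
(mod 4)` with every prime `q ∣ d` good and `a_q` odd (`hS`), at every odd bad prime `ℓ` EITHER
`(d/ℓ) = 1` OR `ℓ` multiplicative with `ord_ℓ(Δ)` odd (`hℓ`), and at `ℓ = 2`: `d ≡ 1 (mod 8)` OR `E`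
has good reduction at `2` (`h2`); `W₁` ANY model of `E^{(d)}`. Cases: `ℓ ∣ N`, `ℓ = 2` — then
`d ≡ 1 (mod 8)` by `h2` (good reduction at `2` contradicts `2 ∣ N`), `d ∈ (ℚ₂^×)²`, the curves are
`ℚ₂`-isomorphic; `ℓ ∣ N` odd — verbatim `padicValNat_two_localTamagawaNumber_twist_eq'` (p522556);
`ℓ ∤ N` — `c_ℓ(E) = 1`, and `c_ℓ(E^{(d)})` is odd at `ℓ ∣ d` (`a_ℓ` odd), `= 1` at `ℓ ∤ d` for EVERY
`ℓ` including `2` (`Rank1Residual.X2.localTamagawaNumber_twist_of_not_dvd`, `d = 4k + 1`).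
[cite: SilvermanAEC2009, VII.1 Prop. 1.3, VII.5 Prop. 5.1(a), VII.6 and X.5 Cor. 5.4]
[cite: SilvermanATAEC1994, Cor. IV.9.2(d) and IV.9.4 Step 2] [cite: MazurRubin2010, Lemma 2.10 (ii), (v)] -/
theorem padicValNat_two_localTamagawaNumber_twist_eq_of_unramified (W : WeierstrassCurve ℚ)
    [W.IsElliptic] [W.IsGloballyMinimal] {d : ℤ} (hd4 : d % 4 = 1)
    (h2 : d % 8 = 1 ∨ W.HasGoodReductionAtPrime 2)
    (hS : ∀ (q : ℕ), q.Prime → (q : ℤ) ∣ d →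
      ¬ (q : ℤ) ∣ minimalDiscriminantInt W ∧ Odd (W.frobeniusTrace q))
    {W₁ : WeierstrassCurve ℚ} [W₁.IsElliptic]
    (h₁ : ∃ C : VariableChange ℚ, C • W₁ = W.quadraticTwist (d : ℚ)) (ℓ : ℕ) [Fact ℓ.Prime]
    (hℓ : ℓ ∣ W.conductorNorm ℤ → ℓ ≠ 2 →
      jacobiSym d ℓ = 1 ∨ (W.HasMultiplicativeReductionAtPrime ℓ ∧ Odd (padicValRat ℓ W.Δ))) :
    padicValNat 2 ((W₁.baseChange ℚ_[ℓ]).localTamagawaNumber ℤ_[ℓ]) =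
      padicValNat 2 ((W.baseChange ℚ_[ℓ]).localTamagawaNumber ℤ_[ℓ]) := by
  have hℓP : ℓ.Prime := Fact.out
  have hd0 : d ≠ 0 := by rintro rfl; norm_num at hd4
  have hdQ : (d : ℚ) ≠ 0 := by exact_mod_cast hd0
  obtain ⟨C, hC⟩ := h₁
  have hWd : C⁻¹ • W.quadraticTwist (d : ℚ) = W₁ := by rw [← hC, inv_smul_smul]
  haveI : (W.baseChange ℚ_[ℓ]).IsElliptic := inferInstanceAs (W.map (algebraMap ℚ ℚ_[ℓ])).IsElliptic
  haveI : (W₁.baseChange ℚ_[ℓ]).IsElliptic := inferInstanceAs (W₁.map (algebraMap ℚ ℚ_[ℓ])).IsElliptic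
  haveI : (W.quadraticTwist (d : ℚ)).IsElliptic := W.isElliptic_quadraticTwist hdQ
  by_cases hℓN : ℓ ∣ W.conductorNorm ℤ
  · by_cases hℓ2 : ℓ = 2
    · -- `ℓ = 2 ∣ N`: by `h2`, `d ≡ 1 (mod 8)` is a square in `ℚ₂`, the two curves are `ℚ₂`-isomorphic
      subst hℓ2
      have hd8 : d % 8 = 1 := by
        rcases h2 with h | hgood
        · exact h
        · exact absurd hgood ((W.dvd_conductorNorm_iff_not_hasGoodReductionAtPrime 2).mp hℓN)
      have hsq : IsSquare ((d : ℤ) : ℚ_[2]) := KramerLocal.padicTwo_isSquare_intCast (by omega)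
      obtain ⟨θ, hθ⟩ := hsq
      have hθ0 : θ ≠ 0 := by
        rintro rfl
        rw [mul_zero] at hθ
        exact hd0 (by exact_mod_cast hθ)
      obtain ⟨C', hC'⟩ := (W.baseChange ℚ_[2]).exists_variableChange_smul_eq_quadraticTwist_sq hθ0
      have h1 : (W.quadraticTwist (d : ℚ)).baseChange ℚ_[2] = C' • W.baseChange ℚ_[2] := by
        rw [hC', WeierstrassCurve.baseChange, WeierstrassCurve.baseChange, map_quadraticTwist, sq,
          map_intCast, hθ]
      have hYX : W₁.baseChange ℚ_[2] = (C⁻¹.map (algebraMap ℚ ℚ_[2]) * C') • W.baseChange ℚ_[2] := by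
        rw [← hWd, WeierstrassCurve.VariableChange.baseChange_smul_eq (W.quadraticTwist (d : ℚ)) C⁻¹
          ℚ_[2], h1, mul_smul]
      rw [hYX, localTamagawaNumber_variableChange_holds ℤ_[2] (W.baseChange ℚ_[2])
        (C⁻¹.map (algebraMap ℚ ℚ_[2]) * C')]
    · rcases hℓ hℓN hℓ2 with hj | ⟨hmult, hodd⟩
      · -- `(d/ℓ) = 1`: `d` is a square in `ℚ_ℓ`, the two curves are `ℚ_ℓ`-isomorphic
        obtain ⟨θ, hθ⟩ := padic_isSquare_of_jacobiSym_eq_one hℓ2 hj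
        have hθ0 : θ ≠ 0 := by
          rintro rfl
          rw [mul_zero] at hθ
          exact hd0 (by exact_mod_cast hθ)
        obtain ⟨C', hC'⟩ := (W.baseChange ℚ_[ℓ]).exists_variableChange_smul_eq_quadraticTwist_sq hθ0
        have h1 : (W.quadraticTwist (d : ℚ)).baseChange ℚ_[ℓ] = C' • W.baseChange ℚ_[ℓ] := by
          rw [hC', WeierstrassCurve.baseChange, WeierstrassCurve.baseChange, map_quadraticTwist, sq,
            map_intCast, hθ]
        have hYX : W₁.baseChange ℚ_[ℓ] =
            (C⁻¹.map (algebraMap ℚ ℚ_[ℓ]) * C') • W.baseChange ℚ_[ℓ] := by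
          rw [← hWd, WeierstrassCurve.VariableChange.baseChange_smul_eq (W.quadraticTwist (d : ℚ))
            C⁻¹ ℚ_[ℓ], h1, mul_smul]
        rw [hYX, localTamagawaNumber_variableChange_holds ℤ_[ℓ] (W.baseChange ℚ_[ℓ])
          (C⁻¹.map (algebraMap ℚ ℚ_[ℓ]) * C')]
      · -- `ℓ` multiplicative with `ord_ℓ(Δ)` odd — both Tamagawa numbers are odd
        have hℓd : ¬ (ℓ : ℤ) ∣ d := fun h => by
          have hgood : W.HasGoodReductionAtPrime ℓ :=
            hasGoodReductionAtPrime_of_not_dvd W ℓ (hS ℓ hℓP h).1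
          exact WeierstrassCurve.HasMultiplicativeReduction.not_hasGoodReduction (R := ℤ_[ℓ]) hmult hgood
        have hoddW : Odd ((W.baseChange ℚ_[ℓ]).localTamagawaNumber ℤ_[ℓ]) := by
          refine odd_localTamagawaNumber_padic_of_mult_of_odd W ℓ hmult ?_
          rw [← cast_minimalDiscriminantInt W, padicValRat.of_int] at hodd
          exact (Int.odd_coe_nat _).mp hodd
        obtain ⟨W₁', hW₁'e, hW₁'m, C₁, hC₁⟩ := exists_isGloballyMinimal_smul_eq_quadraticTwist W hdQ
        haveI := hW₁'e
        haveI := hW₁'m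
        have hmult' : W₁'.HasMultiplicativeReductionAtPrime ℓ :=
          hasMultiplicativeReductionAtPrime_of_twist_of_not_dvd W ℓ hℓ2 hd0 hℓd ⟨C₁, hC₁⟩ hmult
        have hodd' : Odd (padicValInt ℓ W₁'.minimalDiscriminantInt) := by
          have h := (even_padicValRat_Δ_iff_of_twist W W₁' hdQ ⟨C₁, hC₁⟩ ℓ).not.mpr
            (Int.not_even_iff_odd.mpr hodd)
          rw [← cast_minimalDiscriminantInt W₁', padicValRat.of_int] at h
          exact (Int.odd_coe_nat _).mp (Int.not_even_iff_odd.mp h)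
        have hoddW₁' : Odd ((W₁'.baseChange ℚ_[ℓ]).localTamagawaNumber ℤ_[ℓ]) :=
          odd_localTamagawaNumber_padic_of_mult_of_odd W₁' ℓ hmult' hodd'
        haveI : (W₁'.baseChange ℚ_[ℓ]).IsElliptic :=
          inferInstanceAs (W₁'.map (algebraMap ℚ ℚ_[ℓ])).IsElliptic
        have hW₁W₁' : W₁ = (C⁻¹ * C₁) • W₁' := by rw [mul_smul, hC₁, hWd]
        have hloc : (W₁.baseChange ℚ_[ℓ]).localTamagawaNumber ℤ_[ℓ] =
            (W₁'.baseChange ℚ_[ℓ]).localTamagawaNumber ℤ_[ℓ] := by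
          rw [hW₁W₁', WeierstrassCurve.VariableChange.baseChange_smul_eq W₁' (C⁻¹ * C₁) ℚ_[ℓ],
            localTamagawaNumber_variableChange_holds ℤ_[ℓ] (W₁'.baseChange ℚ_[ℓ])]
        rw [hloc, padicValNat.eq_zero_of_not_dvd (Nat.two_dvd_ne_zero.mpr (Nat.odd_iff.mp hoddW₁')),
          padicValNat.eq_zero_of_not_dvd (Nat.two_dvd_ne_zero.mpr (Nat.odd_iff.mp hoddW))]
  · -- `ℓ ∤ N`: `W` is good at `ℓ`, `c_ℓ(W) = 1`
    have hgood : W.HasGoodReductionAtPrime ℓ := by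
      by_contra h
      exact hℓN ((W.dvd_conductorNorm_iff_not_hasGoodReductionAtPrime ℓ).mpr h)
    have hcW : (W.baseChange ℚ_[ℓ]).localTamagawaNumber ℤ_[ℓ] = 1 := by
      haveI : ((W.baseChange ℚ_[ℓ]).minimal ℤ_[ℓ]).HasGoodReduction ℤ_[ℓ] := hgood
      exact localTamagawaNumber_eq_one_of_hasGoodReduction_holds ℤ_[ℓ] _
    rw [hcW, padicValNat_one_right]
    by_cases hℓd : (ℓ : ℤ) ∣ d
    · -- `ℓ = q ∣ d` (odd): `E(ℚ_q)[2] = 0` (a_q odd) ⇒ `E^{(d)}(ℚ_q)[2] = 0` ⇒ `c_q(E^{(d)})` odd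
      have hℓ2 : ℓ ≠ 2 := by rintro rfl; have : (2 : ℤ) ∣ d := hℓd; omega
      obtain ⟨hℓΔ, hodd⟩ := hS ℓ hℓP hℓd
      have hE : ∀ Q : (W.baseChange ℚ_[ℓ]).toAffine.Point, 2 • Q = 0 → Q = 0 :=
        (forall_two_nsmul_eq_zero_iff_odd_frobeniusTrace W hℓ2 hℓΔ).mpr hodd
      obtain ⟨W₁', hW₁'e, hW₁'m, C₁, hC₁⟩ := exists_isGloballyMinimal_smul_eq_quadraticTwist W hdQ
      haveI := hW₁'e
      haveI := hW₁'m
      have hE' : ∀ Q : (W₁'.baseChange ℚ_[ℓ]).toAffine.Point, 2 • Q = 0 → Q = 0 :=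
        (TwoTorsionField.forall_two_nsmul_eq_zero_iff_of_twist W hdQ W₁' ⟨C₁, hC₁⟩).mp hE
      have hc₁odd := ((forall_two_nsmul_eq_zero_iff_odd_tamagawa_and_odd_frobeniusTrace W₁' ℓ
        hℓ2).mp hE').1
      haveI : (W₁'.baseChange ℚ_[ℓ]).IsElliptic :=
        inferInstanceAs (W₁'.map (algebraMap ℚ ℚ_[ℓ])).IsElliptic
      have hW₁W₁' : W₁ = (C⁻¹ * C₁) • W₁' := by rw [mul_smul, hC₁, hWd]
      have hloc : (W₁.baseChange ℚ_[ℓ]).localTamagawaNumber ℤ_[ℓ] =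
          (W₁'.baseChange ℚ_[ℓ]).localTamagawaNumber ℤ_[ℓ] := by
        rw [hW₁W₁', WeierstrassCurve.VariableChange.baseChange_smul_eq W₁' (C⁻¹ * C₁) ℚ_[ℓ],
          localTamagawaNumber_variableChange_holds ℤ_[ℓ] (W₁'.baseChange ℚ_[ℓ])]
      rw [hloc]
      exact padicValNat.eq_zero_of_not_dvd (Nat.two_dvd_ne_zero.mpr (Nat.odd_iff.mp hc₁odd))
    · -- `ℓ ∤ N d` (ANY `ℓ`, `2` included): unramified twist, good reduction preserved, `c_ℓ = 1`
      have h4 : d = 4 * (d / 4) + 1 := by omega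
      rw [Rank1Residual.X2.localTamagawaNumber_twist_of_not_dvd W ℓ h4 hℓd hgood C⁻¹ hWd,
        padicValNat_one_right]

/-! ## §2 The `2`-adic Tamagawa balance -/

/-- `ord_p` of a finite product of non-zero naturals is the sum of the `ord_p`. [folklore] -/
private theorem padicValNat_finset_prod₄ (p : ℕ) [Fact p.Prime] {ι : Type*} (s : Finset ι)
    (f : ι → ℕ) (hf : ∀ i ∈ s, f i ≠ 0) :
    padicValNat p (∏ i ∈ s, f i) = ∑ i ∈ s, padicValNat p (f i) := by
  induction s using Finset.induction_on with
  | empty => simp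
  | insert a s ha ih =>
    rw [Finset.prod_insert ha, Finset.sum_insert ha,
      padicValNat.mul (hf a (Finset.mem_insert_self a s))
        (Finset.prod_ne_zero_iff.mpr fun i hi => hf i (Finset.mem_insert_of_mem hi)),
      ih fun i hi => hf i (Finset.mem_insert_of_mem hi)]

/-- **`ord₂ ∏_ℓ c_ℓ(E^{(d)}) = ord₂ ∏_ℓ c_ℓ(E)` for `d ≡ 1 (mod 4)`, under «`d ≡ 1 (mod 8)` OR `E` good
at `2`»** — the per-twist-pair Tamagawa balance `hc` of the U2 end-to-end heads (HOME/RESIDUE.md R-A7)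
as a CLASS THEOREM on the a_q-odd class WITHOUT the `2`-adic splitting condition when the base has good
reduction at `2`: `W / ℚ` globally minimal elliptic, every prime `q ∣ d` good with `a_q` odd (`hS`),
the odd additive primes and the odd even-`ord` multiplicative primes split in `ℚ(√d)` (`hadd`, `hmev`,
verbatim the binders of the U2 heads); `W₁` ANY model of `E^{(d)}`. For `d ≡ 5 (mod 8)` this is the
R-A3′ row «removed for bases with good reduction at `2`» on the Tamagawa side.
[cite: SilvermanAEC2009, VII.1 Prop. 1.3, VII.5 Prop. 5.1(a), VII.6 and X.5 Cor. 5.4]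
[cite: SilvermanATAEC1994, Cor. IV.9.2(d) and IV.9.4 Step 2] [cite: MazurRubin2010, Prop. 3.3 and Lemma 2.10 (ii), (v)] -/
theorem padicValNat_two_tamagawaProduct_twist_eq_of_unramified (W : WeierstrassCurve ℚ)
    [W.IsElliptic] [W.IsGloballyMinimal] {d : ℤ} (hd4 : d % 4 = 1)
    (h2 : d % 8 = 1 ∨ W.HasGoodReductionAtPrime 2)
    (hS : ∀ (q : ℕ), q.Prime → (q : ℤ) ∣ d →
      ¬ (q : ℤ) ∣ minimalDiscriminantInt W ∧ Odd (W.frobeniusTrace q))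
    (hadd : ∀ (p : ℕ) [Fact p.Prime], ¬ W.HasGoodReductionAtPrime p →
      ¬ W.HasMultiplicativeReductionAtPrime p → p ≠ 2 → jacobiSym d p = 1)
    (hmev : ∀ (p : ℕ) [Fact p.Prime], W.HasMultiplicativeReductionAtPrime p →
      Even (padicValRat p W.Δ) → p ≠ 2 → jacobiSym d p = 1)
    {W₁ : WeierstrassCurve ℚ} [W₁.IsElliptic]
    (h₁ : ∃ C : VariableChange ℚ, C • W₁ = W.quadraticTwist (d : ℚ)) :
    padicValNat 2 W₁.tamagawaProduct = padicValNat 2 W.tamagawaProduct := by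
  haveI : Fact (Nat.Prime 2) := ⟨Nat.prime_two⟩
  -- the per-prime hypothesis of §1 from `hadd` / `hmev`
  have hℓ : ∀ (ℓ : ℕ) [Fact ℓ.Prime], ℓ ∣ W.conductorNorm ℤ → ℓ ≠ 2 →
      jacobiSym d ℓ = 1 ∨ (W.HasMultiplicativeReductionAtPrime ℓ ∧ Odd (padicValRat ℓ W.Δ)) := by
    intro ℓ _ hℓN hℓ2
    by_cases hm : W.HasMultiplicativeReductionAtPrime ℓ
    · by_cases he : Even (padicValRat ℓ W.Δ)
      · exact Or.inl (hmev ℓ hm he hℓ2)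
      · exact Or.inr ⟨hm, Int.not_even_iff_odd.mp he⟩
    · exact Or.inl (hadd ℓ ((W.dvd_conductorNorm_iff_not_hasGoodReductionAtPrime ℓ).mp hℓN) hm hℓ2)
  have hfW : (W.badPlaces ℤ).Finite := W.finite_badPlaces_holds ℤ
  have hfW₁ : (W₁.badPlaces ℤ).Finite := W₁.finite_badPlaces_holds ℤ
  set s : Finset (HeightOneSpectrum ℤ) := hfW.toFinset ∪ hfW₁.toFinset with hs
  have hsW : ∀ v, ¬ W.HasGoodReductionAt v → v ∈ s := fun v hv ↦
    Finset.mem_union_left _ (by rw [Set.Finite.mem_toFinset, mem_badPlaces_iff]; exact hv)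
  have hsW₁ : ∀ v, ¬ W₁.HasGoodReductionAt v → v ∈ s := fun v hv ↦
    Finset.mem_union_right _ (by rw [Set.Finite.mem_toFinset, mem_badPlaces_iff]; exact hv)
  rw [tamagawaProduct_eq_prod W s hsW, tamagawaProduct_eq_prod W₁ s hsW₁,
    padicValNat_finset_prod₄ 2 s _ fun v _ ↦ ?_, padicValNat_finset_prod₄ 2 s _ fun v _ ↦ ?_]
  · refine Finset.sum_congr rfl fun v _ ↦ ?_
    haveI := Fact.mk (primesEquiv v).2
    exact padicValNat_two_localTamagawaNumber_twist_eq_of_unramified W hd4 h2 hS h₁ (primesEquiv v)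
      (hℓ (primesEquiv v))
  · haveI := Fact.mk (primesEquiv v).2
    haveI : (W₁.baseChange ℚ_[primesEquiv v]).IsElliptic :=
      inferInstanceAs (W₁.map (algebraMap ℚ ℚ_[primesEquiv v])).IsElliptic
    exact localTamagawaNumber_padic_ne_zero_holds (primesEquiv v) _
  · haveI := Fact.mk (primesEquiv v).2
    haveI : (W.baseChange ℚ_[primesEquiv v]).IsElliptic :=
      inferInstanceAs (W.map (algebraMap ℚ ℚ_[primesEquiv v])).IsElliptic
    exact localTamagawaNumber_padic_ne_zero_holds (primesEquiv v) _

end Summit.BirchSwinnertonDyer.Uniform.U2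

end
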